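import Summits.PneNP.PneNP.Theorems.SfmBlMachineHatDP
import Summits.PneNP.PneNP.Theorems.SfmBlMachineHatConn

/-!
# Line «sfm-bl», MACHINE LAYER M4-SEM (part 4): `hatSum` = Σ_s Σ_{W ∈ 𝒲 s} meet · #bad completions (stmt-PneNP-20523)

FRONTIER F-N1c; nothing here bears on P vs NP.

The assembled M4 semantics.  In the generic dictionary setting of `SfmBlMachineHatPairs` (one spot: finite leg type
`E`, `srcE`, `dstE`, `outE`, record map `φ` onto the duplicate-free leg list `xs`, label maps `ι₁`, `ι₂`), with the
sublist cap `≥ 2^{#left pieces}, 2^{#right pieces}` and the walk cap not binding: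
* **`sum_spotRecs_eq`** — `Σ_{rec ∈ spotRecs} meet(rec) · badCount G k T0 m rec
   = Σ_{W ∈ 𝒲} #{e : srcE e ∈ W₁ ∨ dstE e ∈ W₂} · #{T ∈ cyl(k,T0) : G·|W₁|·|W₂| < (Σ_j #{e : outE e = j, srcE e ∈ W₁, dstE e ∈ W₂} χ(T j))²}`
  with `𝒲 = ((image srcE).powerset ×ˢ (image dstE).powerset).filter IsConnectedPair` — exactly the right-hand side of
  p3's `SfmBl.sum_cylinder_hat_eq` for the families `𝒲 s` / `bad s T` of `SfmBl.cutCertified_of_pipeline` defined by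
  these filters (bijection `w ↦ (toW₁ w.1, toW₂ w.2)` with inverse `ofW`, `Finset.sum_nbij'`);
* `hatSum_allRecs_eq` — `hatSum` over `allRecs` is the sum over the spots `s < r` of the per-spot sums.
-/

set_option linter.dupNamespace false -- `Summit.PneNP.PneNP.…`: summit = sub-problem name (D-0017 single-conjunct layout)

namespace Summit.PneNP.PneNP.Theorems.SfmBlMachine

open Finset
open Summit.PneNP.PneNP.Theorems.CandCutNorm (boolSign)
open Summit.PneNP.PneNP.Theorems.SfmBl (IsConnectedPair)

section Spot

variable {α β E : Type} [Fintype E] [DecidableEq α] [DecidableEq β]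
  {ι₁ : α → Lab} {ι₂ : β → Lab} {srcE : E → α} {dstE : E → β} {φ : E → PLeg} {xs : List PLeg} {m : ℕ}

/-- Membership in the machine's list of connected sub-pairs (caps not binding on the sublists). -/
theorem mem_filter_subPairs_iff {capS capW : ℕ} (hcapS : 2 ^ (lpieces xs).length ≤ capS ∧ 2 ^ (rpieces xs).length ≤ capS)
    (w : Cand) :
    w ∈ (subPairs capS xs).filter (connTest capW xs) ↔
      List.Sublist w.1 (lpieces xs) ∧ List.Sublist w.2 (rpieces xs) ∧ connTest capW xs w = true := by
  have hprod : ∀ (l₁ l₂ : List (List Lab)), w ∈ l₁.product l₂ ↔ w.1 ∈ l₁ ∧ w.2 ∈ l₂ := fun l₁ l₂ => by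
    obtain ⟨w₁, w₂⟩ := w; exact List.mem_product
  unfold subPairs
  rw [List.mem_filter, sublistsC_eq_sublists hcapS.1, sublistsC_eq_sublists hcapS.2, hprod,
    List.mem_sublists, List.mem_sublists, and_assoc]

/-- The machine's list of connected sub-pairs has no duplicates. -/
theorem nodup_filter_subPairs {capS capW : ℕ} (hcapS : 2 ^ (lpieces xs).length ≤ capS ∧ 2 ^ (rpieces xs).length ≤ capS) :
    ((subPairs capS xs).filter (connTest capW xs)).Nodup := by
  unfold subPairs
  rw [sublistsC_eq_sublists hcapS.1, sublistsC_eq_sublists hcapS.2]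
  exact ((List.nodup_sublists.2 (List.nodup_dedup _)).product (List.nodup_sublists.2 (List.nodup_dedup _))).filter _

/-- THE SUMMAND OF ONE SUB-PAIR in the pipeline's terms. -/
theorem summand_eq (outE : E → Fin m) (hO : ∀ e, (φ e).1 = (outE e).val) (hφ : Function.Injective φ)
    (hxs : xs.Nodup) (hmem : ∀ x, x ∈ xs ↔ ∃ e, φ e = x) (hL : ∀ e, labL (φ e) = ι₁ (srcE e))
    (hR : ∀ e, labR (φ e) = ι₂ (dstE e)) (hι₁ : Function.Injective ι₁) (hι₂ : Function.Injective ι₂)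
    (G k : ℕ) (T0 : List Bool) {w : Cand} (hw₁ : List.Sublist w.1 (lpieces xs)) (hw₂ : List.Sublist w.2 (rpieces xs)) :
    meetCount xs w * badCount G k T0 m (mkRec xs w)
      = (univ.filter fun e => srcE e ∈ toW₁ ι₁ srcE w.1 ∨ dstE e ∈ toW₂ ι₂ dstE w.2).card *
        (univ.filter fun T : Fin m → Bool =>
          (∀ j ∈ univ.filter (fun j : Fin m => (j : ℕ) < k), T j = T0.getD j.val false) ∧
          ((G * ((toW₁ ι₁ srcE w.1).card * (toW₂ ι₂ dstE w.2).card) : ℕ) : ℤ)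
            < (∑ j, ((univ.filter fun e => outE e = j ∧ srcE e ∈ toW₁ ι₁ srcE w.1 ∧ dstE e ∈ toW₂ ι₂ dstE w.2).card : ℤ)
                * boolSign (T j)) ^ 2).card := by
  have hout : ∀ x ∈ legsIn xs w, x.1 < m := by
    intro x hx
    obtain ⟨e, _, rfl⟩ := (mem_legsIn_iff hmem hL hR w x).1 hx
    rw [hO]; exact (outE e).isLt
  unfold mkRec
  rw [meetCount_eq_card hφ hxs hmem hL hR w, badCount_eq G k T0 _ _ (legsIn xs w) hout,
    card_toW₁ hmem hL hι₁ hw₁, card_toW₂ hmem hR hι₂ hw₂]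
  congr 2
  ext T
  simp only [mem_filter, mem_univ, true_and]
  refine and_congr_right fun _ => ?_
  have hc : ∀ j : Fin m, (cOut (legsIn xs w) j.val : ℤ)
      = ((univ.filter fun e => outE e = j ∧ srcE e ∈ toW₁ ι₁ srcE w.1 ∧ dstE e ∈ toW₂ ι₂ dstE w.2).card : ℤ) := by
    intro j
    rw [cOut_legsIn_eq_card hφ hxs hmem hL hR w j.val]
    congr 2
    refine filter_congr fun e _ => ?_
    rw [hO]
    exact ⟨fun h => ⟨Fin.ext h.1, h.2⟩, fun h => ⟨congrArg Fin.val h.1, h.2⟩⟩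
  rw [Finset.sum_congr rfl (fun j _ => by rw [hc j])]

open scoped Classical in
/-- **THE PER-SPOT SUM IDENTITY** (M4-SEM): the machine's `Σ_rec meet · badCount` over the connected sub-pairs of one
spot is the pipeline's `Σ_{W ∈ 𝒲} meet(W) · #{bad completions}` (families filtered classically, as in the pipeline). -/
theorem sum_spotRecs_eq (outE : E → Fin m) (hO : ∀ e, (φ e).1 = (outE e).val) (hφ : Function.Injective φ)
    (hxs : xs.Nodup) (hmem : ∀ x, x ∈ xs ↔ ∃ e, φ e = x) (hL : ∀ e, labL (φ e) = ι₁ (srcE e))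
    (hR : ∀ e, labR (φ e) = ι₂ (dstE e)) (hι₁ : Function.Injective ι₁) (hι₂ : Function.Injective ι₂)
    (h01 : ∀ a, (ι₁ a).1 = 0) (h11 : ∀ b, (ι₂ b).1 = 1) {capS capW : ℕ}
    (hcapS : 2 ^ (lpieces xs).length ≤ capS ∧ 2 ^ (rpieces xs).length ≤ capS)
    (hcapW : ∀ (W : Cand) (k : ℕ), k ≤ 2 * ((lpieces xs).length + (rpieces xs).length) →
      (walksU (legsIn xs W) k).length ≤ capW)
    (G k : ℕ) (T0 : List Bool) :
    ((spotRecs capS capW xs).map fun rec => rec.2.1 * badCount G k T0 m rec).sum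
      = ∑ W ∈ ((univ.image srcE).powerset ×ˢ (univ.image dstE).powerset).filter
            (fun W => IsConnectedPair (fun i k => ∃ e, srcE e = i ∧ dstE e = k) W.1 W.2),
          (univ.filter fun e => srcE e ∈ W.1 ∨ dstE e ∈ W.2).card *
          (univ.filter fun T : Fin m → Bool =>
            (∀ j ∈ univ.filter (fun j : Fin m => (j : ℕ) < k), T j = T0.getD j.val false) ∧
            ((G * (W.1.card * W.2.card) : ℕ) : ℤ)
              < (∑ j, ((univ.filter fun e => outE e = j ∧ srcE e ∈ W.1 ∧ dstE e ∈ W.2).card : ℤ)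
                  * boolSign (T j)) ^ 2).card := by
  classical
  -- the cap on walks, in the form `connTest_iff` wants, for sublists of the pieces
  have hcap' : ∀ {w₁ w₂ : List Lab}, List.Sublist w₁ (lpieces xs) → List.Sublist w₂ (rpieces xs) →
      ∀ k', k' ≤ 2 * ((w₁ ++ w₂).length - 1) → (walksU (legsIn xs (w₁, w₂)) k').length ≤ capW := by
    intro w₁ w₂ h1 h2 k' hk'
    refine hcapW (w₁, w₂) k' (hk'.trans ?_)
    have := h1.length_le; have := h2.length_le
    rw [List.length_append]; omega
  -- list sum → finset sum over the (duplicate-free) list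
  unfold spotRecs
  rw [List.map_map, ← List.sum_toFinset _ (nodup_filter_subPairs hcapS)]
  -- the bijection `w ↦ (toW₁ w.1, toW₂ w.2)`
  refine Finset.sum_nbij' (fun w => (toW₁ ι₁ srcE w.1, toW₂ ι₂ dstE w.2)) (fun W => (ofW₁ ι₁ xs W.1, ofW₂ ι₂ xs W.2))
    (fun w hw => ?_) (fun W hW => ?_) (fun w hw => ?_) (fun W hW => ?_) (fun w hw => ?_)
  · -- into `𝒲`
    rw [List.mem_toFinset, mem_filter_subPairs_iff hcapS] at hw
    obtain ⟨h1, h2, hc⟩ := hw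
    rw [mem_filter, mem_product, mem_powerset, mem_powerset]
    refine ⟨⟨filter_subset _ _, filter_subset _ _⟩, ?_⟩
    exact (connTest_iff hmem hL hR hι₁ hι₂ h01 h11 h1 h2 (hcap' h1 h2)).1 (by rw [Prod.mk.eta]; exact hc)
  · -- back into the list
    rw [mem_filter, mem_product, mem_powerset, mem_powerset] at hW
    obtain ⟨⟨hW1, hW2⟩, hc⟩ := hW
    rw [List.mem_toFinset, mem_filter_subPairs_iff hcapS]
    have h1 : List.Sublist (ofW₁ ι₁ xs W.1) (lpieces xs) := List.filter_sublist
    have h2 : List.Sublist (ofW₂ ι₂ xs W.2) (rpieces xs) := List.filter_sublist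
    refine ⟨h1, h2, ?_⟩
    rw [connTest_iff hmem hL hR hι₁ hι₂ h01 h11 h1 h2 (hcap' h1 h2), toW₁_ofW₁ hmem hL hι₁ hW1,
      toW₂_ofW₂ hmem hR hι₂ hW2]
    exact hc
  · -- left inverse
    rw [List.mem_toFinset, mem_filter_subPairs_iff hcapS] at hw
    obtain ⟨h1, h2, _⟩ := hw
    exact Prod.ext (ofW₁_toW₁ hmem hL h1) (ofW₂_toW₂ hmem hR h2)
  · -- right inverse
    rw [mem_filter, mem_product, mem_powerset, mem_powerset] at hW
    exact Prod.ext (toW₁_ofW₁ hmem hL hι₁ hW.1.1) (toW₂_ofW₂ hmem hR hι₂ hW.1.2)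
  · -- the summands agree
    rw [List.mem_toFinset, mem_filter_subPairs_iff hcapS] at hw
    obtain ⟨h1, h2, _⟩ := hw
    have := summand_eq outE hO hφ hxs hmem hL hR hι₁ hι₂ G k T0 (w := w) h1 h2
    simpa only [Function.comp, mkRec] using this

end Spot

/-- A list sum over `List.range` is a `Finset.range` sum. -/
theorem sum_map_range_eq {M : Type} [AddCommMonoid M] (f : ℕ → M) (r : ℕ) :
    ((List.range r).map f).sum = ∑ s ∈ Finset.range r, f s := by
  rw [← List.toFinset_range, List.sum_toFinset _ (List.nodup_range)]

/-- **`hatSum` over all spots is the sum of the per-spot sums.** -/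
theorem hatSum_allRecs_eq (capS capW : ℕ) (plegs : List PLeg) (labels : List ℕ) (r G k : ℕ) (T0 : List Bool) (m : ℕ) :
    hatSum G k T0 m (allRecs capS capW plegs labels r)
      = ∑ s ∈ Finset.range r,
          ((spotRecs capS capW (slegs plegs labels s)).map fun rec => rec.2.1 * badCount G k T0 m rec).sum := by
  unfold hatSum allRecs
  rw [List.map_flatten, List.sum_flatten, List.map_map, List.map_map, ← sum_map_range_eq]
  rfl

end Summit.PneNP.PneNP.Theorems.SfmBlMachine
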